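import Literature.Analysis.FluidPDE.GaussWeightedBiotSavartBounds
import Literature.Analysis.FluidPDE.PlanarAngularDerivative
import Literature.Analysis.FluidPDE.KerWeightBounds
import HarnessLib

/-!
# The weighted skew identity `⟨Λw, (w + Φψ)⟩_{L²(e^{a|x|²/4})} = 0` for the linearised Burgers operator

Analysis/FluidPDE file (all results proved, no definitions, no named facts). Notation (all written
as explicit functions): `v = K_{2D} ∗ w` (`biotSavart2D w`), `ψ = N ∗ w` the logarithmic
potential (`fun x => ∫ y, w y * ((2π)⁻¹ * log ‖x − y‖)`, so `∇ψ = −v^⊥`), `Φ = kerWeight |x|`,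
`Ω = G/(2Φ) = (8π)⁻¹ φ(|x|²/4)` the angular velocity of the Gaussian vortex, `u = w + Φψ`, and
`Λw = ⟪v^G, ∇w⟫ + ⟪v, ∇G⟫` the linearisation of the Biot–Savart nonlinearity at `G`. By
`gaussLambda_eq_mul_fderiv_perp` (file `PlanarAngularDerivative`), `Λw = Ω ∂_θ u`, whence for the
Gaussian weight `p(x) = e^{a|x|²/4}`, `a ≤ 1`,

  `∫ p (Λw) u = ∫ (pΩ) u ∂_θu = 0`   (`main theorem integral_gaussWeight_mul_gaussLambda_mul_eq_zero`)

for every `w ∈ C²_c(ℝ²)`: the right skew-symmetrizer of Maekawa 2009, Lemma 1.1, in the form used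
for energy estimates in `L²(G_λ⁻¹)`, `G_λ⁻¹ ∝ e^{(1−λ)|x|²/4}`. The file also provides the
Gaussian-domination toolkit (`integrable_of_norm_le_poly_mul_gauss`, growth/decay bounds for `ψ`, `v`, `u`,
`∇u`) used by the uniform energy estimate.

## References

* Y. Maekawa, *Existence of asymmetric Burgers vortices and their asymptotic behavior at large
  circulations*, Math. Models Methods Appl. Sci. 19 (2009), Lemma 1.1, §3–§4. [Maekawa2009b]
* Th. Gallay, Y. Maekawa, *Existence and stability of viscous vortices*, arXiv:1610.08384, §4.1.
  [GallayMaekawa2016]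
-/

noncomputable section

open Set Function Filter MeasureTheory Metric Real
open scoped InnerProductSpace RealInnerProductSpace Topology

namespace Literature.Analysis.FluidPDE

/-! ### Gaussian domination ⇒ integrability -/

/-- `(1 + t)^N e^{−c t²} ≤ C e^{−c t²/2}` for `t ≥ 0` (`c > 0`). [folklore] -/
theorem exists_one_add_pow_mul_exp_neg_le {c : ℝ} (hc : 0 < c) (N : ℕ) :
    ∃ C, 0 < C ∧ ∀ t, 0 ≤ t → (1 + t) ^ N * Real.exp (-(c * t ^ 2)) ≤
      C * Real.exp (-(c / 2 * t ^ 2)) := by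
  -- `(1+t)^N ≤ (1+t)^{2N} = (1 + 2t + t²)^N ≤ (2(1+t²))^N` and `(1+s)^N e^{-(c/2)s} ≤ C`
  set M : ℝ := max 1 (2 / c) with hM
  have hM1 : 1 ≤ M := le_max_left _ _
  have hMc : 2 / c ≤ M := le_max_right _ _
  have hNf : (0 : ℝ) < N.factorial := by exact_mod_cast N.factorial_pos
  refine ⟨2 ^ N * M ^ N * 2 ^ N * (1 + N.factorial), by positivity, fun t ht => ?_⟩
  set s := t ^ 2 with hs
  have hs0 : 0 ≤ s := sq_nonneg t
  -- step 1: `(1+t)^N ≤ 2^N (1+s)^N`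
  have h1 : (1 + t) ^ N ≤ 2 ^ N * (1 + s) ^ N := by
    have h1a : (1 + t) ^ N ≤ (1 + t) ^ (2 * N) :=
      pow_le_pow_right₀ (by linarith) (by omega)
    have h1b : (1 + t) ^ (2 * N) = ((1 + t) ^ 2) ^ N := by rw [pow_mul]
    have h1c : (1 + t) ^ 2 ≤ 2 * (1 + s) := by rw [hs]; nlinarith [sq_nonneg (t - 1)]
    calc (1 + t) ^ N ≤ ((1 + t) ^ 2) ^ N := by rw [← h1b]; exact h1a
      _ ≤ (2 * (1 + s)) ^ N := pow_le_pow_left₀ (by positivity) h1c N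
      _ = 2 ^ N * (1 + s) ^ N := by rw [mul_pow]
  -- step 2: `(1+s)^N ≤ M^N (1+x)^N` with `x = (c/2) s`
  set x := c / 2 * s with hx
  have hx0 : 0 ≤ x := by positivity
  have h2 : (1 + s) ^ N ≤ M ^ N * (1 + x) ^ N := by
    rw [← mul_pow]
    refine pow_le_pow_left₀ (by positivity) ?_ N
    have : s = (2 / c) * x := by rw [hx]; field_simp
    rw [this]
    nlinarith [mul_nonneg (sub_nonneg.2 hMc) hx0, hM1]
  -- step 3: `(1+x)^N ≤ 2^N (1 + N! e^x)`
  have h3 : (1 + x) ^ N ≤ 2 ^ N * ((1 + N.factorial) * Real.exp x) := by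
    have hxN : x ^ N ≤ N.factorial * Real.exp x := by
      have := Real.pow_div_factorial_le_exp x hx0 N
      rwa [div_le_iff₀ hNf, mul_comm] at this
    have hmax : 1 + x ≤ 2 * max 1 x := by
      rcases le_total 1 x with h | h
      · rw [max_eq_right h]; linarith
      · rw [max_eq_left h]; linarith
    have hmaxN : (max 1 x) ^ N ≤ 1 + x ^ N := by
      rcases le_total 1 x with h | h
      · rw [max_eq_right h]; linarith [show (0:ℝ) ≤ 1 from zero_le_one]
      · rw [max_eq_left h, one_pow]; linarith [pow_nonneg hx0 N]
    have he1 : 1 ≤ Real.exp x := Real.one_le_exp hx0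
    calc (1 + x) ^ N ≤ (2 * max 1 x) ^ N := pow_le_pow_left₀ (by positivity) hmax N
      _ = 2 ^ N * (max 1 x) ^ N := mul_pow _ _ _
      _ ≤ 2 ^ N * (1 + x ^ N) := by gcongr
      _ ≤ 2 ^ N * ((1 + N.factorial) * Real.exp x) := by
          gcongr
          nlinarith
  -- assemble
  have hexp : Real.exp x * Real.exp (-(c * t ^ 2)) = Real.exp (-(c / 2 * t ^ 2)) := by
    rw [← Real.exp_add]; congr 1; rw [hx, hs]; ring
  calc (1 + t) ^ N * Real.exp (-(c * t ^ 2))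
      ≤ (2 ^ N * (M ^ N * (2 ^ N * ((1 + N.factorial) * Real.exp x)))) * Real.exp (-(c * t ^ 2)) := by
        gcongr
        exact h1.trans (mul_le_mul_of_nonneg_left (h2.trans
          (mul_le_mul_of_nonneg_left h3 (by positivity))) (by positivity))
    _ = 2 ^ N * M ^ N * 2 ^ N * (1 + N.factorial) * (Real.exp x * Real.exp (-(c * t ^ 2))) := by
        ring
    _ = _ := by rw [hexp]

/-- **Gaussian domination ⇒ integrability on `ℝ²`**: if `‖f x‖ ≤ C (1 + |x|)^N e^{μ|x|²}` with
`μ < 0` and `f` is a.e.-strongly measurable, then `f` is integrable. [folklore] -/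
theorem integrable_of_norm_le_poly_mul_gauss {F : Type*} [NormedAddCommGroup F]
    {f : EuclideanSpace ℝ (Fin 2) → F} {C μ : ℝ} {N : ℕ}
    (hf : AEStronglyMeasurable f volume) (hμ : μ < 0)
    (hb : ∀ x, ‖f x‖ ≤ C * (1 + ‖x‖) ^ N * Real.exp (μ * ‖x‖ ^ 2)) : Integrable f := by
  have hC : 0 ≤ C := by
    have := (norm_nonneg (f 0)).trans (hb 0)
    simpa using this
  obtain ⟨K, hK, hKb⟩ := exists_one_add_pow_mul_exp_neg_le (neg_pos.2 hμ) N
  have hgauss := integrable_exp_neg_mul_norm_sq_two (β := -μ / 2) (by linarith)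
  refine (hgauss.const_mul (C * K)).mono' hf (Eventually.of_forall fun x => ?_)
  have h := hKb ‖x‖ (norm_nonneg x)
  calc ‖f x‖ ≤ C * (1 + ‖x‖) ^ N * Real.exp (μ * ‖x‖ ^ 2) := hb x
    _ = C * ((1 + ‖x‖) ^ N * Real.exp (-(-μ * ‖x‖ ^ 2))) := by rw [neg_mul, neg_neg]; ring
    _ ≤ C * (K * Real.exp (-(-μ / 2 * ‖x‖ ^ 2))) := mul_le_mul_of_nonneg_left h hC
    _ = C * K * Real.exp (-(-μ / 2 * ‖x‖ ^ 2)) := by ring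

/-- A continuous compactly supported function is dominated by ANY Gaussian:
`‖f x‖ ≤ C e^{μ|x|²}` for some `C ≥ 0` (every real `μ`). [folklore] -/
theorem exists_norm_le_exp_of_hasCompactSupport {F : Type*} [NormedAddCommGroup F]
    {f : EuclideanSpace ℝ (Fin 2) → F} (hf : Continuous f) (hfc : HasCompactSupport f) (μ : ℝ) :
    ∃ C, 0 ≤ C ∧ ∀ x, ‖f x‖ ≤ C * Real.exp (μ * ‖x‖ ^ 2) := by
  obtain ⟨A, hA⟩ := hf.bounded_above_of_compact_support hfc
  obtain ⟨R, hR⟩ := hfc.isCompact.isBounded.subset_closedBall 0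
  have hA0 : 0 ≤ A := (norm_nonneg _).trans (hA 0)
  refine ⟨A * Real.exp (|μ| * R ^ 2), by positivity, fun x => ?_⟩
  by_cases hx : x ∈ tsupport f
  · have hxR : ‖x‖ ≤ R := by simpa using hR hx
    have hR0 : 0 ≤ R := (norm_nonneg x).trans hxR
    have h1 : -(|μ| * R ^ 2) ≤ μ * ‖x‖ ^ 2 := by
      have h2 : |μ * ‖x‖ ^ 2| ≤ |μ| * R ^ 2 := by
        rw [abs_mul, abs_of_nonneg (sq_nonneg ‖x‖)]
        exact mul_le_mul_of_nonneg_left (pow_le_pow_left₀ (norm_nonneg _) hxR 2) (abs_nonneg _)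
      linarith [neg_abs_le (μ * ‖x‖ ^ 2)]
    calc ‖f x‖ ≤ A := hA x
      _ = A * Real.exp (|μ| * R ^ 2) * Real.exp (-(|μ| * R ^ 2)) := by
          rw [mul_assoc, ← Real.exp_add, add_neg_cancel, Real.exp_zero, mul_one]
      _ ≤ A * Real.exp (|μ| * R ^ 2) * Real.exp (μ * ‖x‖ ^ 2) := by gcongr
  · rw [image_eq_zero_of_notMem_tsupport hx, norm_zero]
    positivity

/-! ### Growth and decay of the potentials of a `C¹_c` vorticity -/

section Potentials

variable {w : EuclideanSpace ℝ (Fin 2) → ℝ} (hw : ContDiff ℝ 1 w) (hwc : HasCompactSupport w)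
include hw hwc

/-- **Growth bounds**: for `w ∈ C¹_c` there is `C` with `|ψ(x)| ≤ C(1 + |x|)`, `|v(x)| ≤ C` and
`‖Dψ(x)‖ ≤ C` (`∇ψ = −v^⊥`). [folklore] -/
theorem exists_logPotential_biotSavart_bound :
    ∃ C, 0 ≤ C ∧ ∀ x,
      |∫ y, w y * ((2 * π)⁻¹ * Real.log ‖x - y‖)| ≤ C * (1 + ‖x‖) ∧
      ‖biotSavart2D w x‖ ≤ C ∧
      ‖fderiv ℝ (fun x => ∫ y, w y * ((2 * π)⁻¹ * Real.log ‖x - y‖)) x‖ ≤ C := by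
  have hwc' := hw.continuous
  obtain ⟨A, hA⟩ := hwc'.bounded_above_of_compact_support hwc
  have hA' : ∀ y, |w y| ≤ A := fun y => by simpa [Real.norm_eq_abs] using hA y
  have hA0 : 0 ≤ A := (abs_nonneg _).trans (hA' 0)
  have hwi : Integrable w := hwc'.integrable_of_hasCompactSupport hwc
  set I₀ := ∫ z, indicator (ball (0 : EuclideanSpace ℝ (Fin 2)) 1) (fun z => ‖z‖⁻¹) z with hI₀
  have hI₀0 : 0 ≤ I₀ := integral_indicator_inv_norm_nonneg
  set N₀ := ∫ y, |w y| with hN₀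
  have hN₀0 : 0 ≤ N₀ := integral_nonneg fun _ => abs_nonneg _
  set N₁ := ∫ y, ‖y‖ * |w y| with hN₁
  have hN₁0 : 0 ≤ N₁ := integral_nonneg fun _ => mul_nonneg (norm_nonneg _) (abs_nonneg _)
  have hP : ∀ x, ∫ y, |w y| * ‖x - y‖⁻¹ ≤ A * I₀ + N₀ := fun x =>
    (integral_mul_inv_norm_sub_le hwi.abs (fun y => abs_nonneg _) hA' x).2
  set C := (2 * π)⁻¹ * (A * I₀ + N₀ + N₀ + N₁) with hC
  have hπ : 0 < (2 * π)⁻¹ := by positivity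
  have hC0 : 0 ≤ C := by positivity
  have hv : ∀ x, ‖biotSavart2D w x‖ ≤ C := by
    intro x
    calc ‖biotSavart2D w x‖ ≤ (2 * π)⁻¹ * ∫ y, |w y| * ‖x - y‖⁻¹ := norm_biotSavart2D_le_integral w x
      _ ≤ (2 * π)⁻¹ * (A * I₀ + N₀) := mul_le_mul_of_nonneg_left (hP x) hπ.le
      _ ≤ C := by rw [hC]; exact mul_le_mul_of_nonneg_left (by linarith) hπ.le
  refine ⟨C, hC0, fun x => ⟨?_, hv x, ?_⟩⟩
  · calc |∫ y, w y * ((2 * π)⁻¹ * Real.log ‖x - y‖)|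
        ≤ (2 * π)⁻¹ * ((∫ y, |w y| * ‖x - y‖⁻¹) + ‖x‖ * N₀ + N₁) :=
          abs_logPotential_le_integral hwc' hwc x
      _ ≤ (2 * π)⁻¹ * ((A * I₀ + N₀) + ‖x‖ * N₀ + N₁) := by gcongr; exact hP x
      _ ≤ C * (1 + ‖x‖) := by
          rw [hC]
          have h0 := norm_nonneg x
          nlinarith [mul_nonneg h0 hA0, mul_nonneg h0 hI₀0, mul_nonneg h0 hN₁0,
            mul_nonneg (mul_nonneg h0 hA0) hI₀0]
  · refine ContinuousLinearMap.opNorm_le_bound _ hC0 fun h => ?_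
    rw [fderiv_logPotential_eq hw hwc x h, norm_neg]
    calc ‖⟪perp (biotSavart2D w x), h⟫‖ ≤ ‖perp (biotSavart2D w x)‖ * ‖h‖ := norm_inner_le_norm _ _
      _ = ‖biotSavart2D w x‖ * ‖h‖ := by rw [norm_perp]
      _ ≤ C * ‖h‖ := mul_le_mul_of_nonneg_right (hv x) (norm_nonneg _)

end Potentials

/-! ### The angular velocity `Ω = G/(2Φ)` and the radial weight `pΩ` -/

/-- `G/(2Φ) = (8π)⁻¹ φ(|x|²/4)`: the angular velocity of the Gaussian vortex. [folklore] -/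
theorem gaussVortexProfile_div_two_mul_kerWeight (x : EuclideanSpace ℝ (Fin 2)) :
    gaussVortexProfile x / (2 * kerWeight ‖x‖) = (8 * π)⁻¹ * burgersPhi (‖x‖ ^ 2 / 4) := by
  rw [kerWeight, gaussVortexProfile]
  have hφ : burgersPhi (‖x‖ ^ 2 / 4) ≠ 0 := (burgersPhi_pos _).ne'
  have he : Real.exp (-(‖x‖ ^ 2 / 4)) ≠ 0 := (Real.exp_pos _).ne'
  have hπ : (π : ℝ) ≠ 0 := Real.pi_pos.ne'
  field_simp
  norm_num

/-- `0 < G/(2Φ) ≤ (8π)⁻¹`. [folklore] -/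
theorem gaussVortexProfile_div_two_mul_kerWeight_le (x : EuclideanSpace ℝ (Fin 2)) :
    0 < gaussVortexProfile x / (2 * kerWeight ‖x‖) ∧
      gaussVortexProfile x / (2 * kerWeight ‖x‖) ≤ (8 * π)⁻¹ := by
  rw [gaussVortexProfile_div_two_mul_kerWeight]
  refine ⟨by have := burgersPhi_pos (‖x‖ ^ 2 / 4); positivity, ?_⟩
  have := burgersPhi_le_one (t := ‖x‖ ^ 2 / 4) (by positivity)
  have hπ : 0 < (8 * π)⁻¹ := by positivity
  nlinarith

/-- The radial profile of the weight `pΩ`: `t ↦ e^{a t/4} (8π)⁻¹ φ(t/4)` has a derivative bounded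
by `C e^{a t /4}` on `t ≥ 0` (for `a ≥ 0`). [folklore] -/
theorem exists_deriv_gaussWeightOmegaAux_bound {a : ℝ} (ha : 0 ≤ a) :
    ∃ C, 0 ≤ C ∧ ∀ t, 0 ≤ t →
      HasDerivAt (fun t : ℝ => Real.exp (a / 4 * t) * ((8 * π)⁻¹ * burgersPhi (t / 4)))
        (a / 4 * Real.exp (a / 4 * t) * ((8 * π)⁻¹ * burgersPhi (t / 4)) +
          Real.exp (a / 4 * t) * ((8 * π)⁻¹ * (deriv burgersPhi (t / 4) * (1 / 4)))) t ∧
      |a / 4 * Real.exp (a / 4 * t) * ((8 * π)⁻¹ * burgersPhi (t / 4)) +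
          Real.exp (a / 4 * t) * ((8 * π)⁻¹ * (deriv burgersPhi (t / 4) * (1 / 4)))| ≤
        C * Real.exp (a / 4 * t) := by
  obtain ⟨M, hM0, hM⟩ := exists_abs_deriv_burgersPhi_le
  have hπ : 0 < (8 * π)⁻¹ := by positivity
  refine ⟨a / 4 * (8 * π)⁻¹ + (8 * π)⁻¹ * (M * (1 / 4)), by positivity, fun t ht => ⟨?_, ?_⟩⟩
  · have h1 : HasDerivAt (fun t : ℝ => Real.exp (a / 4 * t)) (a / 4 * Real.exp (a / 4 * t)) t := by
      have := ((hasDerivAt_id t).const_mul (a / 4)).exp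
      simp only [id_eq, mul_one] at this
      convert this using 1; ring
    have h2 : HasDerivAt (fun t : ℝ => (8 * π)⁻¹ * burgersPhi (t / 4))
        ((8 * π)⁻¹ * (deriv burgersPhi (t / 4) * (1 / 4))) t := by
      have h3 : HasDerivAt (fun t : ℝ => burgersPhi (t / 4)) (deriv burgersPhi (t / 4) * (1 / 4)) t := by
        have := (StrainedAzimuthal.hasDerivAt_burgersPhi (t / 4)).comp t
          ((hasDerivAt_id t).div_const 4)
        simp only [Function.comp_def, id_eq, one_div] at this ⊢
        exact this
      exact h3.const_mul _
    exact h1.mul h2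
  · have hφ1 : |burgersPhi (t / 4)| ≤ 1 := by
      rw [abs_of_pos (burgersPhi_pos _)]; exact burgersPhi_le_one (by positivity)
    have hφ' : |deriv burgersPhi (t / 4)| ≤ M := hM _ (by positivity)
    have he : 0 < Real.exp (a / 4 * t) := Real.exp_pos _
    calc |a / 4 * Real.exp (a / 4 * t) * ((8 * π)⁻¹ * burgersPhi (t / 4)) +
          Real.exp (a / 4 * t) * ((8 * π)⁻¹ * (deriv burgersPhi (t / 4) * (1 / 4)))|
        ≤ |a / 4 * Real.exp (a / 4 * t) * ((8 * π)⁻¹ * burgersPhi (t / 4))| +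
          |Real.exp (a / 4 * t) * ((8 * π)⁻¹ * (deriv burgersPhi (t / 4) * (1 / 4)))| :=
          abs_add_le _ _
      _ = a / 4 * Real.exp (a / 4 * t) * ((8 * π)⁻¹ * |burgersPhi (t / 4)|) +
          Real.exp (a / 4 * t) * ((8 * π)⁻¹ * (|deriv burgersPhi (t / 4)| * (1 / 4))) := by
          simp only [abs_mul, abs_of_nonneg (show (0:ℝ) ≤ a / 4 by positivity), abs_of_pos he,
            abs_of_pos hπ, abs_of_nonneg (show (0:ℝ) ≤ 1 / 4 by positivity)]
      _ ≤ a / 4 * Real.exp (a / 4 * t) * ((8 * π)⁻¹ * 1) +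
          Real.exp (a / 4 * t) * ((8 * π)⁻¹ * (M * (1 / 4))) := by gcongr
      _ = (a / 4 * (8 * π)⁻¹ + (8 * π)⁻¹ * (M * (1 / 4))) * Real.exp (a / 4 * t) := by ring

/-- **The weight `F = pΩ` of the skew identity**: `F(x) = e^{a|x|²/4} G(x)/(2Φ(|x|))` is `C¹`,
radial (`∂_θF = 0`), `0 < F ≤ (8π)⁻¹ e^{a|x|²/4}` and `‖DF(x)‖ ≤ C |x| e^{a|x|²/4}` (`a ≥ 0`).
[folklore] -/
theorem gaussWeightOmega_props {a : ℝ} (ha : 0 ≤ a) :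
    ContDiff ℝ 1 (fun x : EuclideanSpace ℝ (Fin 2) =>
        Real.exp (a / 4 * ‖x‖ ^ 2) * (gaussVortexProfile x / (2 * kerWeight ‖x‖))) ∧
    (∀ x : EuclideanSpace ℝ (Fin 2), fderiv ℝ (fun x : EuclideanSpace ℝ (Fin 2) =>
        Real.exp (a / 4 * ‖x‖ ^ 2) * (gaussVortexProfile x / (2 * kerWeight ‖x‖))) x (perp x) = 0) ∧
    (∀ x : EuclideanSpace ℝ (Fin 2),
        0 < Real.exp (a / 4 * ‖x‖ ^ 2) * (gaussVortexProfile x / (2 * kerWeight ‖x‖)) ∧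
        Real.exp (a / 4 * ‖x‖ ^ 2) * (gaussVortexProfile x / (2 * kerWeight ‖x‖)) ≤
          (8 * π)⁻¹ * Real.exp (a / 4 * ‖x‖ ^ 2)) ∧
    ∃ C, 0 ≤ C ∧ ∀ x : EuclideanSpace ℝ (Fin 2), ‖fderiv ℝ (fun x : EuclideanSpace ℝ (Fin 2) =>
        Real.exp (a / 4 * ‖x‖ ^ 2) * (gaussVortexProfile x / (2 * kerWeight ‖x‖))) x‖ ≤
          C * ‖x‖ * Real.exp (a / 4 * ‖x‖ ^ 2) := by
  -- radial profile
  set Fr : ℝ → ℝ := fun t => Real.exp (a / 4 * t) * ((8 * π)⁻¹ * burgersPhi (t / 4)) with hFr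
  have hFeq : (fun x : EuclideanSpace ℝ (Fin 2) =>
      Real.exp (a / 4 * ‖x‖ ^ 2) * (gaussVortexProfile x / (2 * kerWeight ‖x‖))) =
      fun x => Fr (‖x‖ ^ 2) := by
    funext x; simp only [hFr, gaussVortexProfile_div_two_mul_kerWeight]
  obtain ⟨C, hC0, hC⟩ := exists_deriv_gaussWeightOmegaAux_bound ha
  have hFr1 : ContDiff ℝ 1 Fr := by
    simp only [hFr]
    have h1 : ContDiff ℝ 1 fun t : ℝ => Real.exp (a / 4 * t) := by fun_prop
    have h2 : ContDiff ℝ 1 fun t : ℝ => (8 * π)⁻¹ * burgersPhi (t / 4) :=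
      contDiff_const.mul ((contDiff_burgersPhi (n := 1)).comp (contDiff_id.div_const 4))
    exact h1.mul h2
  have hn2 : ContDiff ℝ 1 fun x : EuclideanSpace ℝ (Fin 2) => ‖x‖ ^ 2 := contDiff_norm_sq ℝ
  refine ⟨?_, ?_, ?_, ?_⟩
  · rw [hFeq]; exact hFr1.comp hn2
  · intro x
    rw [hFeq]
    exact fderiv_perp_eq_zero_of_radial ((hFr1.differentiable one_ne_zero) _)
  · intro x
    obtain ⟨h0, h1⟩ := gaussVortexProfile_div_two_mul_kerWeight_le x
    have he := Real.exp_pos (a / 4 * ‖x‖ ^ 2)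
    exact ⟨mul_pos he h0, by nlinarith⟩
  · refine ⟨2 * C, by positivity, fun x => ?_⟩
    rw [hFeq]
    have ht : 0 ≤ ‖x‖ ^ 2 := sq_nonneg _
    obtain ⟨hd, hb⟩ := hC (‖x‖ ^ 2) ht
    have hcomp : HasFDerivAt (Fr ∘ fun y : EuclideanSpace ℝ (Fin 2) => ‖y‖ ^ 2)
        ((a / 4 * Real.exp (a / 4 * ‖x‖ ^ 2) * ((8 * π)⁻¹ * burgersPhi (‖x‖ ^ 2 / 4)) +
          Real.exp (a / 4 * ‖x‖ ^ 2) * ((8 * π)⁻¹ * (deriv burgersPhi (‖x‖ ^ 2 / 4) * (1 / 4)))) •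
          (2 • innerSL ℝ x)) x :=
      HasDerivAt.comp_hasFDerivAt (h₂ := Fr) x hd (hasStrictFDerivAt_norm_sq x).hasFDerivAt
    change ‖fderiv ℝ (Fr ∘ fun y : EuclideanSpace ℝ (Fin 2) => ‖y‖ ^ 2) x‖ ≤ _
    rw [hcomp.fderiv, norm_smul, Real.norm_eq_abs]
    have hin : ‖(2 : ℕ) • innerSL ℝ x‖ ≤ 2 * ‖x‖ := by
      rw [two_nsmul, ← two_smul ℝ, norm_smul, Real.norm_two, innerSL_apply_norm]
    calc _ ≤ C * Real.exp (a / 4 * ‖x‖ ^ 2) * (2 * ‖x‖) :=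
          mul_le_mul hb hin (norm_nonneg _) (by positivity)
      _ = 2 * C * ‖x‖ * Real.exp (a / 4 * ‖x‖ ^ 2) := by ring

/-! ### The kernel weight `Φ(|x|)`: Gaussian bounds -/

/-- `Φ(r) ≤ (1 + r²/4) e^{−r²/4}` (from `Φ² ≤ (1 + r²/4)² e^{−r²/2}`); private copy of the
Summits-side `arnold_kerWeight_le` (not importable from Literature). [folklore] -/
private theorem kerWeight_le_mul_exp_neg (r : ℝ) :
    kerWeight r ≤ (1 + r ^ 2 / 4) * Real.exp (-(r ^ 2 / 4)) := by
  have h := kerWeight_sq_le r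
  have h0 : 0 ≤ (1 + r ^ 2 / 4) * Real.exp (-(r ^ 2 / 4)) := by positivity
  have hsq : ((1 + r ^ 2 / 4) * Real.exp (-(r ^ 2 / 4))) ^ 2 =
      (1 + r ^ 2 / 4) ^ 2 * Real.exp (-(r ^ 2 / 2)) := by
    rw [mul_pow, sq (Real.exp _), ← Real.exp_add]; ring_nf
  rw [← hsq] at h
  exact (pow_le_pow_iff_left₀ (kerWeight_pos r).le h0 two_ne_zero).1 h

/-- `Φ(|x|) ≤ (1 + |x|)² e^{−|x|²/4}` and `‖D(Φ(|·|))(x)‖ ≤ C (1 + |x|)⁵ e^{−|x|²/4}`. [folklore] -/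
theorem exists_kerWeight_norm_gauss_bound :
    ∃ C, 0 ≤ C ∧ ∀ x : EuclideanSpace ℝ (Fin 2),
      kerWeight ‖x‖ ≤ (1 + ‖x‖) ^ 2 * Real.exp (-(‖x‖ ^ 2 / 4)) ∧
      ‖fderiv ℝ (fun y : EuclideanSpace ℝ (Fin 2) => kerWeight ‖y‖) x‖ ≤
        C * (1 + ‖x‖) ^ 5 * Real.exp (-(‖x‖ ^ 2 / 4)) := by
  obtain ⟨C, hC0, hC⟩ := exists_norm_fderiv_kerWeight_norm_le
  refine ⟨C, hC0, fun x => ⟨?_, ?_⟩⟩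
  · have h := kerWeight_le_mul_exp_neg ‖x‖
    have hr := norm_nonneg x
    have h1 : 1 + ‖x‖ ^ 2 / 4 ≤ (1 + ‖x‖) ^ 2 := by nlinarith
    exact h.trans (mul_le_mul_of_nonneg_right h1 (Real.exp_pos _).le)
  · have h := hC x
    have hr := norm_nonneg x
    have h1 : (1 + ‖x‖ ^ 2 / 4) ^ 2 * ‖x‖ ≤ (1 + ‖x‖) ^ 5 := by
      have h2 : 1 + ‖x‖ ^ 2 / 4 ≤ (1 + ‖x‖) ^ 2 := by nlinarith
      have h3 : (1 + ‖x‖ ^ 2 / 4) ^ 2 ≤ ((1 + ‖x‖) ^ 2) ^ 2 :=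
        pow_le_pow_left₀ (by positivity) h2 2
      have h4 : ‖x‖ ≤ 1 + ‖x‖ := by linarith
      calc (1 + ‖x‖ ^ 2 / 4) ^ 2 * ‖x‖ ≤ ((1 + ‖x‖) ^ 2) ^ 2 * (1 + ‖x‖) :=
            mul_le_mul h3 h4 hr (by positivity)
        _ = (1 + ‖x‖) ^ 5 := by ring
    calc ‖fderiv ℝ (fun y : EuclideanSpace ℝ (Fin 2) => kerWeight ‖y‖) x‖
        ≤ C * (1 + ‖x‖ ^ 2 / 4) ^ 2 * ‖x‖ * Real.exp (-(‖x‖ ^ 2 / 4)) := h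
      _ = C * ((1 + ‖x‖ ^ 2 / 4) ^ 2 * ‖x‖) * Real.exp (-(‖x‖ ^ 2 / 4)) := by ring
      _ ≤ C * (1 + ‖x‖) ^ 5 * Real.exp (-(‖x‖ ^ 2 / 4)) := by gcongr

/-! ### The corrected vorticity `u = w + Φψ` -/

section Corrected

variable {w : EuclideanSpace ℝ (Fin 2) → ℝ} (hw : ContDiff ℝ 2 w) (hwc : HasCompactSupport w)
include hw hwc

/-- `u = w + Φ(|x|) ψ` is `C¹` for `w ∈ C²_c`. [folklore] -/
theorem contDiff_one_corrected :
    ContDiff ℝ 1 fun x => w x + kerWeight ‖x‖ * ∫ y, w y * ((2 * π)⁻¹ * Real.log ‖x - y‖) :=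
  (hw.of_le (by norm_num)).add (contDiff_kerWeight_norm.mul
    (contDiff_logPotential (n := 1) (hw.of_le (by norm_num)) hwc))

/-- **Gaussian decay of `u` and `∇u`**: `|u(x)| ≤ C(1+|x|)³ e^{−|x|²/4}` and
`‖Du(x)‖ ≤ C (1+|x|)⁶ e^{−|x|²/4}` for `u = w + Φψ`, `w ∈ C²_c` (the correction `Φψ` is a
Gaussian times a logarithmically growing potential). [folklore] -/
theorem exists_corrected_gauss_bound :
    ∃ C, 0 ≤ C ∧ ∀ x,
      |w x + kerWeight ‖x‖ * ∫ y, w y * ((2 * π)⁻¹ * Real.log ‖x - y‖)| ≤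
        C * (1 + ‖x‖) ^ 3 * Real.exp (-(‖x‖ ^ 2 / 4)) ∧
      ‖fderiv ℝ (fun x => w x + kerWeight ‖x‖ * ∫ y, w y * ((2 * π)⁻¹ * Real.log ‖x - y‖)) x‖ ≤
        C * (1 + ‖x‖) ^ 6 * Real.exp (-(‖x‖ ^ 2 / 4)) := by
  have hw1 : ContDiff ℝ 1 w := hw.of_le (by norm_num)
  set ψ : EuclideanSpace ℝ (Fin 2) → ℝ := fun x => ∫ y, w y * ((2 * π)⁻¹ * Real.log ‖x - y‖)
    with hψ
  have hψ1 : ContDiff ℝ 1 ψ := contDiff_logPotential (n := 1) hw1 hwc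
  obtain ⟨Cw, hCw0, hCw⟩ := exists_norm_le_exp_of_hasCompactSupport hw.continuous hwc (-(1 / 4))
  obtain ⟨Cw', hCw0', hCw'⟩ := exists_norm_le_exp_of_hasCompactSupport
    (hw1.continuous_fderiv one_ne_zero) (hwc.fderiv (𝕜 := ℝ)) (-(1 / 4))
  obtain ⟨Cψ, hCψ0, hCψ⟩ := exists_logPotential_biotSavart_bound hw1 hwc
  obtain ⟨CΦ, hCΦ0, hCΦ⟩ := exists_kerWeight_norm_gauss_bound
  have hexp : ∀ x : EuclideanSpace ℝ (Fin 2), Real.exp (-(1 / 4) * ‖x‖ ^ 2) =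
      Real.exp (-(‖x‖ ^ 2 / 4)) := fun x => by ring_nf
  refine ⟨Cw + Cψ + Cw' + Cψ * CΦ, by positivity, fun x => ?_⟩
  have hr := norm_nonneg x
  set E := Real.exp (-(‖x‖ ^ 2 / 4)) with hE
  have hE0 : 0 < E := Real.exp_pos _
  have h1r : 1 ≤ 1 + ‖x‖ := by linarith
  obtain ⟨hψx, -, hψ'x⟩ := hCψ x
  obtain ⟨hΦx, hΦ'x⟩ := hCΦ x
  have hwx : |w x| ≤ Cw * E := by rw [← Real.norm_eq_abs, hE, ← hexp]; exact hCw x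
  have hw'x : ‖fderiv ℝ w x‖ ≤ Cw' * E := by rw [hE, ← hexp]; exact hCw' x
  have hΦ0 : 0 ≤ kerWeight ‖x‖ := (kerWeight_pos _).le
  constructor
  · calc |w x + kerWeight ‖x‖ * ψ x| ≤ |w x| + |kerWeight ‖x‖ * ψ x| := abs_add_le _ _
      _ = |w x| + kerWeight ‖x‖ * |ψ x| := by rw [abs_mul, abs_of_nonneg hΦ0]
      _ ≤ Cw * E + (1 + ‖x‖) ^ 2 * E * (Cψ * (1 + ‖x‖)) := by gcongr
      _ = (Cw + Cψ * (1 + ‖x‖) ^ 3) * E := by ring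
      _ ≤ (Cw * (1 + ‖x‖) ^ 3 + Cψ * (1 + ‖x‖) ^ 3) * E := by
          gcongr
          exact le_mul_of_one_le_right hCw0 (one_le_pow₀ h1r)
      _ ≤ (Cw + Cψ + Cw' + Cψ * CΦ) * (1 + ‖x‖) ^ 3 * E := by
          have : 0 ≤ (Cw' + Cψ * CΦ) * (1 + ‖x‖) ^ 3 * E := by positivity
          nlinarith
  · -- derivative of `u`
    have hwd : HasFDerivAt w (fderiv ℝ w x) x := ((hw1.differentiable one_ne_zero) x).hasFDerivAt
    have hψd : HasFDerivAt ψ (fderiv ℝ ψ x) x := ((hψ1.differentiable one_ne_zero) x).hasFDerivAt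
    have hΦd : HasFDerivAt (fun y : EuclideanSpace ℝ (Fin 2) => kerWeight ‖y‖)
        (fderiv ℝ (fun y : EuclideanSpace ℝ (Fin 2) => kerWeight ‖y‖) x) x :=
      (differentiableAt_kerWeight_norm x).hasFDerivAt
    have hud := hwd.fun_add (hΦd.fun_mul hψd)
    rw [show (fun x => w x + kerWeight ‖x‖ * ∫ y, w y * ((2 * π)⁻¹ * Real.log ‖x - y‖)) =
        fun y => w y + kerWeight ‖y‖ * ψ y from rfl, hud.fderiv]
    calc ‖fderiv ℝ w x + (kerWeight ‖x‖ • fderiv ℝ ψ x +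
          ψ x • fderiv ℝ (fun y : EuclideanSpace ℝ (Fin 2) => kerWeight ‖y‖) x)‖
        ≤ ‖fderiv ℝ w x‖ + (‖kerWeight ‖x‖ • fderiv ℝ ψ x‖ +
          ‖ψ x • fderiv ℝ (fun y : EuclideanSpace ℝ (Fin 2) => kerWeight ‖y‖) x‖) :=
          norm_add_le_of_le le_rfl (norm_add_le _ _)
      _ = ‖fderiv ℝ w x‖ + (kerWeight ‖x‖ * ‖fderiv ℝ ψ x‖ +
          |ψ x| * ‖fderiv ℝ (fun y : EuclideanSpace ℝ (Fin 2) => kerWeight ‖y‖) x‖) := by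
          rw [norm_smul, norm_smul, Real.norm_of_nonneg hΦ0, Real.norm_eq_abs]
      _ ≤ Cw' * E + ((1 + ‖x‖) ^ 2 * E * Cψ + Cψ * (1 + ‖x‖) * (CΦ * (1 + ‖x‖) ^ 5 * E)) := by
          have i1 : kerWeight ‖x‖ * ‖fderiv ℝ ψ x‖ ≤ (1 + ‖x‖) ^ 2 * E * Cψ :=
            mul_le_mul hΦx hψ'x (norm_nonneg _) (by positivity)
          have i2 : |ψ x| * ‖fderiv ℝ (fun y : EuclideanSpace ℝ (Fin 2) => kerWeight ‖y‖) x‖ ≤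
              Cψ * (1 + ‖x‖) * (CΦ * (1 + ‖x‖) ^ 5 * E) :=
            mul_le_mul hψx hΦ'x (norm_nonneg _) (by positivity)
          linarith [hw'x]
      _ = (Cw' + Cψ * (1 + ‖x‖) ^ 2 + Cψ * CΦ * (1 + ‖x‖) ^ 6) * E := by ring
      _ ≤ (Cw' * (1 + ‖x‖) ^ 6 + Cψ * (1 + ‖x‖) ^ 6 + Cψ * CΦ * (1 + ‖x‖) ^ 6) * E := by
          have j1 : Cw' ≤ Cw' * (1 + ‖x‖) ^ 6 := le_mul_of_one_le_right hCw0' (one_le_pow₀ h1r)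
          have j2 : Cψ * (1 + ‖x‖) ^ 2 ≤ Cψ * (1 + ‖x‖) ^ 6 :=
            mul_le_mul_of_nonneg_left (pow_le_pow_right₀ h1r (by norm_num)) hCψ0
          exact mul_le_mul_of_nonneg_right (by linarith) hE0.le
      _ ≤ (Cw + Cψ + Cw' + Cψ * CΦ) * (1 + ‖x‖) ^ 6 * E := by
          have : 0 ≤ Cw * (1 + ‖x‖) ^ 6 * E := by positivity
          nlinarith

/-- **The weighted skew identity `∫ e^{a|x|²/4} (Λw) (w + Φψ) = 0`** (`0 ≤ a ≤ 1`, `w ∈ C²_c`):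
with `Λw = Ω ∂_θ(w + Φψ)` (`gaussLambda_eq_mul_fderiv_perp`, `∇ψ = −v^⊥`) the integrand is
`(pΩ) u ∂_θu` with the radial `C¹` weight `pΩ`, and `∫ F u ∂_θ u = 0`
(`integral_mul_mul_fderiv_perp_eq_zero`); the three weighted products are Gaussian-dominated
(`(1+|x|)^{10} e^{(a−2)|x|²/4}`). This is `⟨Λ h, T⁻¹h⟩ = 0`-type skew-symmetry behind Maekawa's
energy estimates in `𝒫ᵉX_λ` (Maekawa 2009, Lemma 1.1, Prop. 4.1). [cite: Maekawa2009b, Lemma 1.1] -/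
theorem integral_gaussWeight_mul_gaussLambda_mul_eq_zero {a : ℝ} (ha0 : 0 ≤ a) (ha1 : a ≤ 1) :
    ∫ x, Real.exp (a / 4 * ‖x‖ ^ 2) *
      (⟪gaussVortexVelocity x, gradient w x⟫ +
        ⟪biotSavart2D w x, gradient gaussVortexProfile x⟫) *
      (w x + kerWeight ‖x‖ * ∫ y, w y * ((2 * π)⁻¹ * Real.log ‖x - y‖)) = 0 := by
  have hw1 : ContDiff ℝ 1 w := hw.of_le (by norm_num)
  set ψ : EuclideanSpace ℝ (Fin 2) → ℝ := fun x => ∫ y, w y * ((2 * π)⁻¹ * Real.log ‖x - y‖)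
    with hψ
  set u : EuclideanSpace ℝ (Fin 2) → ℝ := fun x => w x + kerWeight ‖x‖ * ψ x with hu
  set F : EuclideanSpace ℝ (Fin 2) → ℝ := fun x =>
    Real.exp (a / 4 * ‖x‖ ^ 2) * (gaussVortexProfile x / (2 * kerWeight ‖x‖)) with hF
  have hψ1 : ContDiff ℝ 1 ψ := contDiff_logPotential (n := 1) hw1 hwc
  have hu1 : ContDiff ℝ 1 u := contDiff_one_corrected hw hwc
  obtain ⟨hF1, hFθ, hFb, CF, hCF0, hCF⟩ := gaussWeightOmega_props ha0
  -- `Λw = Ω ∂_θ u`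
  have hΛ : ∀ x, ⟪gaussVortexVelocity x, gradient w x⟫ +
      ⟪biotSavart2D w x, gradient gaussVortexProfile x⟫ =
      gaussVortexProfile x / (2 * kerWeight ‖x‖) * fderiv ℝ u x (perp x) := by
    intro x
    refine gaussLambda_eq_mul_fderiv_perp ((hw1.differentiable one_ne_zero) x)
      ((hψ1.differentiable one_ne_zero) x) ?_
    rw [hψ, fderiv_logPotential_eq hw1 hwc, inner_perp_perp]
  have hint_eq : (fun x => Real.exp (a / 4 * ‖x‖ ^ 2) *
      (⟪gaussVortexVelocity x, gradient w x⟫ +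
        ⟪biotSavart2D w x, gradient gaussVortexProfile x⟫) * u x) =
      fun x => F x * u x * fderiv ℝ u x (perp x) := by
    funext x; rw [hΛ x]; simp only [hF]; ring
  change ∫ x, Real.exp (a / 4 * ‖x‖ ^ 2) *
      (⟪gaussVortexVelocity x, gradient w x⟫ +
        ⟪biotSavart2D w x, gradient gaussVortexProfile x⟫) * u x = 0
  rw [hint_eq]
  -- Gaussian bounds
  obtain ⟨Cu, hCu0, hCu⟩ := exists_corrected_gauss_bound hw hwc
  have hμ : (a - 2) / 4 < 0 := by linarith
  have hexp3 : ∀ x : EuclideanSpace ℝ (Fin 2), Real.exp (a / 4 * ‖x‖ ^ 2) *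
      Real.exp (-(‖x‖ ^ 2 / 4)) * Real.exp (-(‖x‖ ^ 2 / 4)) =
      Real.exp ((a - 2) / 4 * ‖x‖ ^ 2) := fun x => by
    rw [← Real.exp_add, ← Real.exp_add]; ring_nf
  have hFle : ∀ x, |F x| ≤ (8 * π)⁻¹ * Real.exp (a / 4 * ‖x‖ ^ 2) := fun x => by
    rw [abs_of_pos (hFb x).1]; exact (hFb x).2
  have hr1 : ∀ x : EuclideanSpace ℝ (Fin 2), ‖x‖ ≤ 1 + ‖x‖ := fun x => by linarith [norm_nonneg x]
  -- continuity facts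
  have hFc : Continuous F := hF1.continuous
  have huc : Continuous u := hu1.continuous
  have hu'c : Continuous fun x => fderiv ℝ u x := hu1.continuous_fderiv one_ne_zero
  have hFu1 : ContDiff ℝ 1 fun y => F y * u y := hF1.mul hu1
  have hFu'c : Continuous fun x => fderiv ℝ (fun y => F y * u y) x := hFu1.continuous_fderiv one_ne_zero
  refine integral_mul_mul_fderiv_perp_eq_zero hF1 hu1 hFθ ?_ ?_ ?_
  · refine integrable_of_norm_le_poly_mul_gauss (C := (8 * π)⁻¹ * Cu * Cu) (N := 7)
      (by fun_prop : Continuous fun x => ‖x‖ * (|F x * u x| * |u x|)).aestronglyMeasurable hμ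
      fun x => ?_
    obtain ⟨hux, -⟩ := hCu x
    rw [Real.norm_of_nonneg (by positivity), abs_mul]
    calc ‖x‖ * (|F x| * |u x| * |u x|)
        ≤ (1 + ‖x‖) * (((8 * π)⁻¹ * Real.exp (a / 4 * ‖x‖ ^ 2)) *
          (Cu * (1 + ‖x‖) ^ 3 * Real.exp (-(‖x‖ ^ 2 / 4))) *
          (Cu * (1 + ‖x‖) ^ 3 * Real.exp (-(‖x‖ ^ 2 / 4)))) := by
          gcongr
          · exact hr1 x
          · exact hFle x
      _ = (8 * π)⁻¹ * Cu * Cu * (1 + ‖x‖) ^ 7 * (Real.exp (a / 4 * ‖x‖ ^ 2) *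
          Real.exp (-(‖x‖ ^ 2 / 4)) * Real.exp (-(‖x‖ ^ 2 / 4))) := by ring
      _ = _ := by rw [hexp3]
  · refine integrable_of_norm_le_poly_mul_gauss (C := (8 * π)⁻¹ * Cu * Cu) (N := 10)
      ((continuous_norm.mul (((hFc.mul huc).abs).mul hu'c.norm)).aestronglyMeasurable) hμ
      fun x => ?_
    obtain ⟨hux, hu'x⟩ := hCu x
    rw [Real.norm_of_nonneg (by positivity), abs_mul]
    calc ‖x‖ * (|F x| * |u x| * ‖fderiv ℝ u x‖)
        ≤ (1 + ‖x‖) * (((8 * π)⁻¹ * Real.exp (a / 4 * ‖x‖ ^ 2)) *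
          (Cu * (1 + ‖x‖) ^ 3 * Real.exp (-(‖x‖ ^ 2 / 4))) *
          (Cu * (1 + ‖x‖) ^ 6 * Real.exp (-(‖x‖ ^ 2 / 4)))) := by
          gcongr
          · exact hr1 x
          · exact hFle x
      _ = (8 * π)⁻¹ * Cu * Cu * (1 + ‖x‖) ^ 10 * (Real.exp (a / 4 * ‖x‖ ^ 2) *
          Real.exp (-(‖x‖ ^ 2 / 4)) * Real.exp (-(‖x‖ ^ 2 / 4))) := by ring
      _ = _ := by rw [hexp3]
  · refine integrable_of_norm_le_poly_mul_gauss (C := ((8 * π)⁻¹ * Cu + Cu * CF) * Cu) (N := 10)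
      ((continuous_norm.mul (hFu'c.norm.mul huc.abs)).aestronglyMeasurable) hμ fun x => ?_
    obtain ⟨hux, hu'x⟩ := hCu x
    have hFd : HasFDerivAt F (fderiv ℝ F x) x := ((hF1.differentiable one_ne_zero) x).hasFDerivAt
    have hud : HasFDerivAt u (fderiv ℝ u x) x := ((hu1.differentiable one_ne_zero) x).hasFDerivAt
    rw [Real.norm_of_nonneg (by positivity), (hFd.fun_mul hud).fderiv]
    have hprod : ‖F x • fderiv ℝ u x + u x • fderiv ℝ F x‖ ≤
        ((8 * π)⁻¹ * Cu + Cu * CF) * (1 + ‖x‖) ^ 6 *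
          (Real.exp (a / 4 * ‖x‖ ^ 2) * Real.exp (-(‖x‖ ^ 2 / 4))) := by
      calc ‖F x • fderiv ℝ u x + u x • fderiv ℝ F x‖
          ≤ ‖F x • fderiv ℝ u x‖ + ‖u x • fderiv ℝ F x‖ := norm_add_le _ _
        _ = |F x| * ‖fderiv ℝ u x‖ + |u x| * ‖fderiv ℝ F x‖ := by
            rw [norm_smul, norm_smul, Real.norm_eq_abs, Real.norm_eq_abs]
        _ ≤ ((8 * π)⁻¹ * Real.exp (a / 4 * ‖x‖ ^ 2)) * (Cu * (1 + ‖x‖) ^ 6 *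
            Real.exp (-(‖x‖ ^ 2 / 4))) + (Cu * (1 + ‖x‖) ^ 3 * Real.exp (-(‖x‖ ^ 2 / 4))) *
            (CF * ‖x‖ * Real.exp (a / 4 * ‖x‖ ^ 2)) := by
            gcongr
            · exact hFle x
            · exact hCF x
        _ = ((8 * π)⁻¹ * Cu * (1 + ‖x‖) ^ 6 + Cu * CF * ((1 + ‖x‖) ^ 3 * ‖x‖)) *
            (Real.exp (a / 4 * ‖x‖ ^ 2) * Real.exp (-(‖x‖ ^ 2 / 4))) := by ring
        _ ≤ ((8 * π)⁻¹ * Cu * (1 + ‖x‖) ^ 6 + Cu * CF * (1 + ‖x‖) ^ 6) *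
            (Real.exp (a / 4 * ‖x‖ ^ 2) * Real.exp (-(‖x‖ ^ 2 / 4))) := by
            gcongr
            calc (1 + ‖x‖) ^ 3 * ‖x‖ ≤ (1 + ‖x‖) ^ 3 * (1 + ‖x‖) := by gcongr; exact hr1 x
              _ = (1 + ‖x‖) ^ 4 := by ring
              _ ≤ (1 + ‖x‖) ^ 6 := pow_le_pow_right₀ (by linarith [norm_nonneg x]) (by norm_num)
        _ = _ := by ring
    calc ‖x‖ * (‖F x • fderiv ℝ u x + u x • fderiv ℝ F x‖ * |u x|)
        ≤ (1 + ‖x‖) * (((8 * π)⁻¹ * Cu + Cu * CF) * (1 + ‖x‖) ^ 6 *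
          (Real.exp (a / 4 * ‖x‖ ^ 2) * Real.exp (-(‖x‖ ^ 2 / 4))) *
          (Cu * (1 + ‖x‖) ^ 3 * Real.exp (-(‖x‖ ^ 2 / 4)))) := by
          gcongr
          exact hr1 x
      _ = ((8 * π)⁻¹ * Cu + Cu * CF) * Cu * (1 + ‖x‖) ^ 10 * (Real.exp (a / 4 * ‖x‖ ^ 2) *
          Real.exp (-(‖x‖ ^ 2 / 4)) * Real.exp (-(‖x‖ ^ 2 / 4))) := by ring
      _ = _ := by rw [hexp3]

end Corrected

end Literature.Analysis.FluidPDE
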